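import Summits.HubbardSuperconductivity.HubbardSuperconductivity.Theorems.AnisotropyChordTransferFibre3L2DeltaCover
import Summits.HubbardSuperconductivity.HubbardSuperconductivity.Theorems.AnisotropyChordTransferFibre3EtaEffLower
import Mathlib.NumberTheory.Harmonic.Bounds
import Mathlib.Analysis.Complex.ExponentialBounds

/-!
# Route `AnisotropyChord` / H0 rotor rung, LEVEL 2 (`∀ L ≥ 128`): the located hypothesis `ν ≥ 2.39·10⁻⁴` holds for every `L ≤ 2^200` at `Δ ≤ 0.98`

The Level-2 cover of the GM₃ window lives on the `ν`-columns `ν = λ₂/θ² ∈ [2.39·10⁻⁴, 0.031]` (p2's `trialGapAbs_L2`, the block/final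
theorems `L2.gm3d_block…` / `L2.gm3_L2_delta98`), so it carries the located hypothesis `ν ≥ 2.39·10⁻⁴` on the ground profile.  By
`etaEff_ge` (`…EtaEffLower`: `η_eff ≥ 1/((8/3)·H_{L/2} + Δ/(1−Δ))`), `η_eff = π²ν` and `H_n ≤ 1 + log n` (Mathlib
`harmonic_le_one_add_log`), that hypothesis is AUTOMATIC in the whole physical range: ★★ `nu_ge_239_of_le`: for `128 ≤ L ≤ 2^200`,
`0 ≤ Δ ≤ 49/50` every ground two-magnon profile has `ν ≥ 2.39·10⁻⁴` (indeed `(8/3)(1 + 199·log 2) + 49 ≤ 420 < 1/(9.8697·2.39·10⁻⁴)`);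
it fails only for `L > e^139` (the `ν → 0` corner, ruling R3).  ★ `nu_loc_of_le`: the corresponding `hν`-discharge for block/final theorems.
Prover seat `hubbard-h0-rotor-p1` g31 (route lead); helper for piece A = stmt-HubbardSuperconductivity-23918 of rung 19089
(`--supports`, helper class).  Nothing here proves superconductivity in the Hubbard model; a location lemma for ONE conditional reduction
(the GM₃ ∀L certificate).  Mathlib + the tree only; no sorry.
-/

set_option linter.dupNamespace false
set_option autoImplicit false

namespace Summit.HubbardSuperconductivity.HubbardSuperconductivity.Theorems.AnisotropyChord.Transfer.Fibre3

namespace L2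

variable (L : ℕ) [NeZero L]

/-- ★★ for `128 ≤ L ≤ 2^200` and `0 ≤ Δ ≤ 49/50`, every ground two-magnon profile has `ν = λ₂/θ² ≥ 2.39·10⁻⁴`. [folklore] -/
theorem nu_ge_239_of_le (hL : 128 ≤ L) (hLmax : L ≤ 2 ^ 200) {Δ lam2 : ℝ} (hΔ0 : 0 ≤ Δ) (hΔ98 : Δ ≤ (49 : ℝ) / 50)
    {f : Tor L → ℝ} (hf : IsGroundTwoMagnon L Δ lam2 f) :
    (239 : ℝ) / 1000000 ≤ lam2 / (2 * Real.pi / L) ^ 2 := by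
  have hΔ1 : Δ < 1 := lt_of_le_of_lt hΔ98 (by norm_num)
  have hη := etaEff_ge L (by omega) hΔ0 hΔ1 hf
  obtain ⟨_, _, _, _, _, _, d7⟩ := ManifoldA.manifold_dictionary L (by omega) hΔ0 hΔ1 hf
  set ν := lam2 / (2 * Real.pi / L) ^ 2 with hν
  -- harmonic bound: `H_{L/2} ≤ 1 + log(L/2) ≤ 1 + 199·log 2 ≤ 139`
  have hH : (harmonic (L / 2) : ℝ) ≤ 139 := by
    have h1 := harmonic_le_one_add_log (L / 2)
    have hL2pos : (0 : ℝ) < ((L / 2 : ℕ) : ℝ) := by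
      have : 64 ≤ L / 2 := by omega
      exact_mod_cast (show 0 < L / 2 by omega)
    have hL2le : ((L / 2 : ℕ) : ℝ) ≤ (2 : ℝ) ^ 199 := by
      have : L / 2 ≤ 2 ^ 199 := by omega
      exact_mod_cast this
    have hlog : Real.log ((L / 2 : ℕ) : ℝ) ≤ 199 * Real.log 2 := by
      have h2 : Real.log ((2 : ℝ) ^ 199) = 199 * Real.log 2 := by
        rw [Real.log_pow]; norm_num
      rw [← h2]; exact Real.log_le_log hL2pos hL2le
    have hl2 := Real.log_two_lt_d9
    linarith
  -- the `Δ` term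
  have hD : Δ / (1 - Δ) ≤ 49 := by
    rw [div_le_iff₀ (by linarith)]; linarith
  have hpos : 0 < 8 / 3 * (harmonic (L / 2) : ℝ) + Δ / (1 - Δ) := by
    have h0 : (0 : ℝ) ≤ Δ / (1 - Δ) := div_nonneg hΔ0 (by linarith)
    have hh : (1 : ℚ) ≤ harmonic (L / 2) := by
      have h64 : 1 ≤ L / 2 := by omega
      have hm : harmonic 1 ≤ harmonic (L / 2) := by
        unfold harmonic
        apply Finset.sum_le_sum_of_subset_of_nonneg (Finset.range_mono h64)
        intro i _ _; positivity
      have h1 : harmonic 1 = 1 := by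
        rw [show (1 : ℕ) = 0 + 1 from rfl, harmonic_succ, harmonic_zero]; norm_num
      linarith
    have hh' : (1 : ℝ) ≤ (harmonic (L / 2) : ℝ) := by exact_mod_cast hh
    linarith
  have hden : 8 / 3 * (harmonic (L / 2) : ℝ) + Δ / (1 - Δ) ≤ 420 := by linarith
  -- `η ≥ 1/420`, `η = π²ν`, `π² < 9.8697`
  have hη' : 1 / (420 : ℝ) ≤ etaEff L lam2 := (one_div_le_one_div_of_le hpos hden).trans hη
  have hπ2 : Real.pi ^ 2 < (98697 : ℝ) / 10000 := by nlinarith [Real.pi_lt_d6, Real.pi_pos]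
  rw [d7] at hη'
  have hν0 : 0 ≤ ν := by
    have hLpos : (0 : ℝ) < L := by exact_mod_cast (show 0 < L by omega)
    have := lam2_pos L (by omega) hΔ1 hf.1
    rw [hν]; positivity
  nlinarith [hη', hπ2, hν0]

/-- ★ the located hypothesis of the block/final theorems, discharged for `128 ≤ L ≤ 2^200`, `0 < Δ ≤ 49/50`: every ground profile has
`ν ∈ [2.39·10⁻⁴, n₂]` as soon as `ν ≤ n₂` is known (here with the universal ceiling `n₂ = 0.031`, `region_sides`). [folklore] -/
theorem nu_loc_of_le (hL : 128 ≤ L) (hLmax : L ≤ 2 ^ 200) {Δ : ℝ} (hΔ0 : 0 < Δ) (hΔ98 : Δ ≤ (49 : ℝ) / 50) :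
    ∀ lam2 : ℝ, ∀ f : Tor L → ℝ, IsGroundTwoMagnon L Δ lam2 f →
      (239 : ℝ) / 1000000 ≤ lam2 / (2 * Real.pi / L) ^ 2 ∧ lam2 / (2 * Real.pi / L) ^ 2 ≤ (31000 : ℝ) / 1000000 := by
  intro lam2 f hf
  have hΔ1 : Δ < 1 := lt_of_le_of_lt hΔ98 (by norm_num)
  refine ⟨nu_ge_239_of_le L hL hLmax hΔ0.le hΔ98 hf, ?_⟩
  have h := (L2.N1.region_sides L hL hΔ0.le hΔ1 hf).2.2
  norm_num at h ⊢; linarith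

end L2

end Summit.HubbardSuperconductivity.HubbardSuperconductivity.Theorems.AnisotropyChord.Transfer.Fibre3
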